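import Mathlib
import HarnessLib
import Literature.NumberTheory.LFunctions.ZetaScrew
import Literature.NumberTheory.LFunctions.WeilGroundStateRealZerosProofs
import Literature.NumberTheory.LFunctions.WeilGroundEnergyProofs
import Literature.NumberTheory.LFunctions.WeilWindowCertifiedProfileCoercivityProofs
import Summits.RiemannHypothesis.RiemannHypothesis.Theorems.IntegerScrewWeilWindowCoerciveFloor

/-!
# Route `IntegerScrew` — the balanced window floor of Suzuki's integer matrices is the Weil GROUND ENERGY:
# `(ε(a)/(4M))·Σ x_m² ≤ Σ G(log m, log m') x_m x_{m'}` on windows of log-length `< 2a` (RH-FREE glue),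
# hence under RH every FIXED ratio has a floor `c(r)/M` uniform in `M` (exponent `A = 1`; RH-CONDITIONAL, labelled)

`IntegerScrewWeilWindowCoerciveFloor.screwWindow_coercive_of_coercive` turns any `L²`-coercivity constant of
Weil's form on `C(a)` into a floor on the balanced windows `(N, M]`, `log M − log(N+1) < 2a`, of the screw
matrices.  The BEST such constant is Bombieri's ground energy `ε(a) = weilGroundEnergy a` (Bombieri 2000
§4: `ε(a)·‖g‖₂² ≤ Re Q(g)` for `g ∈ C(a)`, tree `ConnesVanSuijlekom.weilGroundEnergy_mul_le_re`).  So: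

* `screwWindow_groundEnergy_floor` (RH-FREE glue): if `0 ≤ ε(a)` (equivalently `WeilPositivityOn a`,
  `weilGroundEnergy_nonneg_iff_holds`) then **`(ε(a)/(4M))·Σ_{(N,M]} x_m² ≤ Σ G(log m, log m') x_m x_{m'}`**
  for every balanced `x` and every window with `log M − log(N+1) < 2a`;
* `screwWindow_floor_of_weilPositivityOn` — the same from the hypothesis `WeilPositivityOn a`;
* `screwWindow_coercive_of_riemannHypothesis` (RH-CONDITIONAL, labelled): under RH, `0 < ε(a)` for every
  `a > 0` (Yoshida 1992 Thm. 2 / Bombieri 2000 Thm. 3, tree `weilGroundEnergy_pos_of_riemannHypothesis'`), so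
  **every fixed-ratio family of balanced windows has a floor `ε((log r)/2)/(4M)`, uniform in `M`, exponent `1`**
  — the balanced-window companion of `FloorOfRH` (RH ⇒ `ScrewPolyFloor`, exponent `2 + δ` for the full matrix).

RH-FREE instances of a POSITIVE constant: ratio `≤ 1 + 3·10⁻⁵` (`screwWindow_coercive_bombieri`,
`¼(log(1/L) − log log(1/L) − 8)`) and ratio `1.004` (`IntegerScrewScrewPolyFloorWindowFloor`, `(1 − log 2)/4`); at
ratio `≤ 7` only `ε ≥ 0` is certified (`WeilFormatCData.A1.weilPositivityOn_one`; the tree's upper bound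
`ε(1) ≤ 5.6·10⁻²⁹`).  Nothing here bears on the truth of RH.

References: E. Bombieri, Rend. Lincei (9) 11 (2000) §4 (Problems 1–2, Thm. 3) [Bombieri2000Weil]; H. Yoshida,
Adv. Stud. Pure Math. 21 (1992) Thm. 2; M. Suzuki, J. Lond. Math. Soc. (2) 108 (2023), Prop. 3.1 [Suzuki2023].
-/

noncomputable section

-- D-0017: `Summit.<S>.<S>.…` is the designed namespace of a single-problem summit.
set_option linter.dupNamespace false

namespace Summit.RiemannHypothesis.RiemannHypothesis.Theorems.IntegerScrew

open Literature.NumberTheory.LFunctions MeasureTheory Set Finset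

/-- **THE GROUND ENERGY IS A WINDOW FLOOR** (RH-FREE glue): if `0 ≤ ε(a)` (`0 < a`), then for all `N, M`
with `log M − log(N+1) < 2a` and every real `x` balanced on `(N, M]`,
`(ε(a)/(4M))·Σ x_m² ≤ Σ G(log m, log m') x_m x_{m'}` (`ε(a)·‖g‖₂² ≤ Re Q(g)` on `C(a)`,
`ConnesVanSuijlekom.weilGroundEnergy_mul_le_re`, and `screwWindow_coercive_of_coercive`). [cite: Bombieri2000Weil, §4 Problem 2] -/
theorem screwWindow_groundEnergy_floor {a : ℝ} (ha : 0 < a) (hε : 0 ≤ weilGroundEnergy a) (N M : ℕ)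
    (hNM : Real.log M - Real.log ((N : ℝ) + 1) < 2 * a) (x : ℕ → ℝ)
    (hx : ∑ m ∈ Ioc N M, x m = 0) :
    weilGroundEnergy a / (4 * M) * ∑ m ∈ Ioc N M, x m ^ 2 ≤
      ∑ m ∈ Ioc N M, ∑ m' ∈ Ioc N M,
        zetaScrewKernel (Real.log m) (Real.log m') * (x m * x m') :=
  screwWindow_coercive_of_coercive ha hε
    (fun _ hF hsupp => ConnesVanSuijlekom.weilGroundEnergy_mul_le_re hF hsupp) N M hNM x hx

/-- The same floor from `WeilPositivityOn a` (which is `0 ≤ ε(a)`, `weilGroundEnergy_nonneg_iff_holds`).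
[cite: Bombieri2000Weil, §4 Problem 2] -/
theorem screwWindow_floor_of_weilPositivityOn {a : ℝ} (ha : 0 < a) (hW : WeilPositivityOn a) (N M : ℕ)
    (hNM : Real.log M - Real.log ((N : ℝ) + 1) < 2 * a) (x : ℕ → ℝ)
    (hx : ∑ m ∈ Ioc N M, x m = 0) :
    weilGroundEnergy a / (4 * M) * ∑ m ∈ Ioc N M, x m ^ 2 ≤
      ∑ m ∈ Ioc N M, ∑ m' ∈ Ioc N M,
        zetaScrewKernel (Real.log m) (Real.log m') * (x m * x m') :=
  screwWindow_groundEnergy_floor ha ((weilGroundEnergy_nonneg_iff_holds ha).2 hW) N M hNM x hx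

/-- **RH ⇒ every fixed log-length has a positive window floor, uniform in `M`** (RH-CONDITIONAL, labelled;
the balanced-window companion of `FloorOfRH` with the exponent `A = 1`): under RH, for every `a > 0`,
`0 < ε(a)` and `(ε(a)/(4M))·Σ x_m² ≤ Σ G(log m, log m') x_m x_{m'}` on every balanced window of
log-length `< 2a`. [cite: Yoshida1992HermitianForms, Thm. 2 (p. 321); Bombieri2000Weil §4 Thm. 3] -/
theorem screwWindow_coercive_of_riemannHypothesis (hRH : _root_.RiemannHypothesis) {a : ℝ} (ha : 0 < a) :
    0 < weilGroundEnergy a ∧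
      ∀ N M : ℕ, Real.log M - Real.log ((N : ℝ) + 1) < 2 * a → ∀ x : ℕ → ℝ,
        ∑ m ∈ Ioc N M, x m = 0 →
          weilGroundEnergy a / (4 * M) * ∑ m ∈ Ioc N M, x m ^ 2 ≤
            ∑ m ∈ Ioc N M, ∑ m' ∈ Ioc N M,
              zetaScrewKernel (Real.log m) (Real.log m') * (x m * x m') :=
  have hε := weilGroundEnergy_pos_of_riemannHypothesis' hRH ha
  ⟨hε, fun N M hNM x hx => screwWindow_groundEnergy_floor ha hε.le N M hNM x hx⟩

/-- Ratio form under RH (RH-CONDITIONAL, labelled): for every ratio `R ≥ 2`, the balanced windows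
`(N, M]` with `M < R(N+1)` have the floor `ε((log R)/2)/(4M)` with `ε((log R)/2) > 0`, uniform in `M`.
[cite: Bombieri2000Weil, §4 Thm. 3] -/
theorem screwWindow_ratio_coercive_of_riemannHypothesis (hRH : _root_.RiemannHypothesis) {R : ℕ}
    (hR : 2 ≤ R) (N M : ℕ) (hNM : M < R * (N + 1)) (x : ℕ → ℝ) (hx : ∑ m ∈ Ioc N M, x m = 0) :
    0 < weilGroundEnergy (Real.log R / 2) ∧
      weilGroundEnergy (Real.log R / 2) / (4 * M) * ∑ m ∈ Ioc N M, x m ^ 2 ≤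
        ∑ m ∈ Ioc N M, ∑ m' ∈ Ioc N M,
          zetaScrewKernel (Real.log m) (Real.log m') * (x m * x m') := by
  have hRr : (2 : ℝ) ≤ R := by exact_mod_cast hR
  have ha : 0 < Real.log R / 2 := by
    have : 0 < Real.log R := Real.log_pos (by linarith)
    linarith
  obtain ⟨hε, h⟩ := screwWindow_coercive_of_riemannHypothesis hRH ha
  refine ⟨hε, ?_⟩
  rcases le_or_gt M N with hMN | hMN
  · simp [Finset.Ioc_eq_empty_of_le hMN]
  refine h N M ?_ x hx
  have hN1 : (0 : ℝ) < (N : ℝ) + 1 := by positivity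
  have hMpos : (0 : ℝ) < M := hN1.trans_le (by exact_mod_cast hMN)
  have hlt : (M : ℝ) < R * ((N : ℝ) + 1) := by exact_mod_cast hNM
  have h1 : Real.log M < Real.log (R * ((N : ℝ) + 1)) := Real.log_lt_log hMpos hlt
  rw [Real.log_mul (by linarith) hN1.ne'] at h1
  linarith

end Summit.RiemannHypothesis.RiemannHypothesis.Theorems.IntegerScrew

end
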